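import Literature.NumberTheory.ComplexMultiplication.FiniteQAlgebraLatticeLocalUnits
import HarnessLib

/-!
# INVERTIBLE full lattices of an ARBITRARY finite-dimensional commutative `ℚ`-algebra `A` are LOCALLY PRINCIPAL
# (Faddeev 1965; Hertling–Larabi 2026 Thm. 7.3 «⇒»), w-EQUIVALENCE = LOCAL EQUIVALENCE (Rem. 7.4), and the
# SURJECTIVITY of `G(Λ_2) → G(Λ_1)`, `L ↦ Λ_1L`, for orders `Λ_2 ⊆ Λ_1` (Thm. 8.2 (b), Step 1) — nilpotents allowed

[topic NumberTheory/ComplexMultiplication] General-`A` series (namespace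
`Literature.NumberTheory.ComplexMultiplication.FiniteQAlgebraLattice`), the general-`A` twin of the `Y = L_1 ⊕ ⋯ ⊕ L_t`
file `CMAlgebraLatticeLocallyPrincipal` (seat p19 gen 32), whose semilocal proof uses nothing of `Y` beyond its ring
structure and the finiteness of `Λ/pΛ`; sequel of `FiniteQAlgebraLatticeLocalization` (def-free localisations «`L_1`,
`L_2` agree at `p`» = `∃ s : ℤ, ¬ ↑p ∣ s ∧ sL_1 ⊆ L_2 ∧ sL_2 ⊆ L_1`, gluing (Thm. 7.2 (c)), Thm. 7.3 «⇐», Rem. 7.4 «⇐»)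
and of `FiniteQAlgebraLatticeLocalUnits` (`1 + pΛ ⊂ Λ_(p)^{unit}` by Nakayama).  Lane `lit-hodgefound` (Track 2
foundations library), seat p19 generation 36, row g36-#8.  THEOREMS ONLY: no definition, no instance, no notation, no
named fact (D-0026, net Literature debt `0`), no `sorry`.

## Source, VERBATIM

C. Hertling, K. Larabi, *Semigroups from full lattices in commutative ℚ-algebras*, arXiv:2602.14973 (2026)
[HertlingLarabi2026], held `paper:arxiv-2602.14973`.  §7 (chunk p0018): «**Theorem 7.3** [Fa65]. Let `A` be as
in Theorem 3.1. Let the full lattice `L ∈ 𝓛(A)` have order `Λ := 𝒪(L)`. Then: `L` is invertible ⟺ `L_(p)` is a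
principal `Λ_(p)`-ideal for each `p ∈ ℙ`, i.e. `L_(p) = a_pΛ_(p)` for some `a_p ∈ A^{unit}` for each `p ∈ ℙ`, with
`a_p = 1_A` for all except finitely many `p`. In fact, in [Fa65] only the more difficult implication ⇒ is proved.
*Proof of the implication ⇐:* […]» — «**Remarks 7.4.** […] By Theorem 5.8 (a) two full lattices `L_1` and `L_2`
are `w`-equivalent if and only if `𝒪(L_1) = 𝒪(L_2)` and an invertible lattice `L_3 ∈ G(𝒪(L_1))` with `L_1L_3 = L_2`
exists (in fact, then `L_3 = L_2:L_1` is unique). By Theorem 7.3 this is equivalent to `(L_2)_(p) = a_p·(L_1)_(p)`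
for each `p ∈ ℙ` with `a_p = 1_A` for almost all `p ∈ ℙ` and `a_p ∈ A^{unit}` for the other `p ∈ ℙ`. Lattices `L_1`
and `L_2` with (7.3) are called locally equivalent. So, in our commutative situation `w`-equivalence and local
equivalence coincide [Fa65].»  §8 (chunk p0021): «**Theorem 8.2.** Let `Λ_1` and `Λ_2` be two orders in `A` with
`Λ_2 ⊊ Λ_1`. […] (b) The following sequence is exact,
`1 → ∏_{p∈P_0}(Λ_2)_(p)^{unit} → ∏_{p∈P_0}(Λ_1)_(p)^{unit} → G(Λ_2) → G(Λ_1) → 1`. Especially, the group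
homomorphism in (8.1) is surjective. […] *Proof:* (b) Step 1: In step 1 we show that the map in (8.1) is surjective.
Let `L_1 ∈ G(Λ_1)`. For almost all `p ∈ ℙ` `(L_1)_(p) = (Λ_1)_(p)`. Define `b_p := 1_A` for these `p`. For the
finitely many `p ∈ ℙ` with `(L_1)_(p) ≠ (Λ_1)_(p)` we have `(L_1)_(p) = b_p(Λ_1)_(p)` for some `b_p ∈ A^{unit}` by
Theorem 7.3 and by `L_1 ∈ G(Λ_1)`. By Theorem 7.2 (c) there is a unique full lattice `L_2` with
`(L_2)_(p) = b_p(Λ_2)_(p)` for each `p ∈ ℙ` […]. By Theorem 7.3 it is in `G(Λ_2)`. Now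
`(Λ_1L_2)_(p) = a_p(Λ_1)_(p)(Λ_2)_(p) = a_p(Λ_1)_(p) = (L_1)_(p)` for each `p ∈ ℙ`, so `Λ_1L_2 = L_1`. The map in
(8.1) is surjective.»

## The proof of «⇒» formalised here (the implication HL cite from [Fa65] without proof)

Standard semilocal argument (the device behind Neukirch, *Algebraic Number Theory* I §12 Prop. (12.4) «`𝔞` is
invertible iff `𝔞_𝔭` is a fractional principal ideal of `𝒪_𝔭` for every `𝔭`» — restated with a pointer to Neukirch
in Lv–Deng, *On orders in number fields: Picard groups, ring class fields and applications*, Sci. China Math.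
(2015), §2 fact (b), held `paper:arxiv-1405.5776` chunk p0004 — and behind «invertible ideals of a semilocal ring
are principal»).  Let `LL' = Λ` (`L' = Λ:L`) and fix a prime `p`.
1. The maximal ideals `𝔪_1, …, 𝔪_k` of the ring `Λ` containing `p` are FINITELY MANY: as additive groups they lie
   between `pΛ` and `Λ` (window finiteness `finite_setOf_le_and_smul_mem`).
2. `LL' = Λ ⊄ 𝔪_j` gives `x_j ∈ L`, `y_j ∈ L'` with `x_jy_j ∉ 𝔪_j`.
3. Chinese remainder theorem (`Ideal.pi_quotient_surjective`): `e_j ∈ Λ` with `e_j ≡ δ_{jl} (mod 𝔪_l)`; put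
   `a := Σ_j e_jx_j ∈ L`; then `a·y_l ≡ x_ly_l ≢ 0 (mod 𝔪_l)` for every `l`.
4. Hence the ideal `aL' + pΛ` of `Λ` lies in no maximal ideal, i.e. `a·y + p·d = 1` with `y ∈ L'`, `d ∈ Λ`.
5. Nakayama (`exists_mem_mul_eq_smul_one_of_one_add` of `FiniteQAlgebraLatticeLocalUnits`): `(a·y)·b = r·1` with `b ∈ Λ`, `p ∤ r`; so `a ∈ A^{unit}`
   and `rL ⊆ aΛ ⊆ L` (`r·m = a·(b·(y·m))`, `y·m ∈ L'L = Λ`), i.e. `L_(p) = aΛ_(p)` with `a ∈ L`.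

## Contents

* §1 `exists_units_mem_locEq_smul_of_mul_div_div_eq` — Thm. 7.3 «⇒» at one prime (`a ∈ L ∩ A^{unit}`).
* §2 `exists_forall_prime_locEq_units_smul_of_mul_div_div_eq` (Thm. 7.3 «⇒» with `a_p = 1` off a finite set),
  the full equivalence `mul_div_div_eq_iff_exists_forall_prime_locEq_units_smul` (Thm. 7.3) and its pointwise
  form `mul_div_div_eq_iff_forall_prime_exists_units_locEq`.
* §3 Rem. 7.4 «⇒» and the equivalence «`w`-equivalent ⟺ locally equivalent» [Fa65]
  (`one_mem_div_mul_div_iff_exists_forall_prime_locEq_units_smul`, pointwise form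
  `one_mem_div_mul_div_iff_forall_prime_exists_units_locEq`).
* §4 Thm. 8.2 (b), Step 1: for orders `Λ_2 ⊆ Λ_1` of `A` and `L_1 ∈ G(Λ_1)` there is `L_2 ∈ G(Λ_2)` with
  `Λ_1L_2 = L_1` (`exists_invertible_order_mul_eq`) — the map `G(Λ_2) → G(Λ_1)`, `L ↦ Λ_1L` (well defined by
  `div_self_order_mul_eq_of_le` of `FiniteQAlgebraLatticeLocalUnits`) is SURJECTIVE; this generalises to arbitrary
  orders of an arbitrary `A` the surjectivity `Pic(𝒪) → Cl(𝒪_K)` of the one-field case.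

All statements are in the vocabulary `Submodule ℤ A` of the general-`A` series (`IsFullLattice`, `*`, `/`, `u • M`);
«invertible» = `L·((L/L)/L) = L/L`, «`𝒪(L) = Λ`» = `L/L = Λ`, «order» = `1 ∈ Λ ∧ ΛΛ ⊆ Λ` (full).

## References

* [HertlingLarabi2026] C. Hertling, K. Larabi, *Semigroups from full lattices in commutative ℚ-algebras*,
  arXiv:2602.14973 (2026), §7 Thm. 7.3, Rem. 7.4 (chunks p0018–p0019); §8 Thm. 8.2 (b) Step 1 (chunk p0021).
  [cite: HertlingLarabi2026, §7 Thm. 7.3 and Rem. 7.4, chunk p0018]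
* [Faddeev1965] D. K. Faddeev, *Introduction to the multiplicative theory of modules of integral representations*,
  Trudy Mat. Inst. Steklov 80 (1965) 145–182, cited by HL as [Fa65] for Thm. 7.3 «⇒».
  [cite: Faddeev1965, as cited by HertlingLarabi2026 §7 Thm. 7.3]
* [NeukirchANT1999] J. Neukirch, *Algebraic Number Theory*, Springer (1999), Ch. I §12 (orders: Prop. (12.4)
  «invertible ⟺ locally principal», Prop. (12.9) the exact sequence ending in `Pic(𝒪) → Pic(𝒪_K) → 0`).
  [cite: NeukirchANT1999, Ch. I §12 Prop. (12.4)]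
* C. Lv, Y. Deng, *On orders in number fields: Picard groups, ring class fields and applications*, Sci. China
  Math. 58 (2015), §2 (facts (a)–(d) about orders, after Neukirch), arXiv:1405.5776, held `paper:arxiv-1405.5776`.
-/

noncomputable section

open scoped Pointwise
open Module Function

open Literature.NumberTheory.Automorphic (IsFullLattice mem_units_smul_submodule_iff finite_setOf_le_and_smul_mem)

namespace Literature.NumberTheory.ComplexMultiplication.FiniteQAlgebraLattice

section LocallyPrincipal

variable {A : Type} [CommRing A] [Algebra ℚ A]

/-! ## §1 Theorem 7.3 «⇒» at one prime: an invertible lattice is principal at `p` -/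

/-- **THEOREM 7.3 «⇒» [Fa65] AT ONE PRIME: if the full lattice `L` is INVERTIBLE (`L·(𝒪(L):L) = 𝒪(L)`), then
for every prime `p` there is `a ∈ L ∩ A^unit` with `L_(p) = a𝒪(L)_(p)`**, i.e. `sL ⊆ a𝒪(L) ⊆ L` for some
`s ∈ ℤ` with `p ∤ s`. Proof: semilocal Chinese-remainder argument over the finitely many maximal ideals of
`𝒪(L)` above `p`, then Nakayama (`1 + p𝒪(L) ⊂ 𝒪(L)_(p)^unit`); see the module docstring.
[cite: HertlingLarabi2026, §7 Thm. 7.3 («L is invertible ⟺ L_(p) is a principal Λ_(p)-ideal for each p»; «in [Fa65] only the more difficult implication ⇒ is proved»), chunk p0018]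
[cite: Faddeev1965, as cited by HertlingLarabi2026 §7 Thm. 7.3] [cite: NeukirchANT1999, I §12 Prop. (12.4) (one number field: `𝔞` invertible ⟺ every `𝔞_𝔭` principal)] -/
theorem exists_units_mem_locEq_smul_of_mul_div_div_eq {M : Submodule ℤ A}
    (hM : IsFullLattice A M) (hinv : M * ((M / M) / M) = M / M) {p : ℕ} (hp : p.Prime) :
    ∃ a : Aˣ, (a : A) ∈ M ∧ a • (M / M) ≤ M ∧ ∃ s : ℤ, ¬ (p : ℤ) ∣ s ∧
      (∀ x ∈ M, s • x ∈ a • (M / M)) ∧ (∀ x ∈ a • (M / M), s • x ∈ M) := by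
  classical
  have hΛ : IsFullLattice A (M / M) := isFullLattice_div hM hM
  have h1 : (1 : A) ∈ M / M := one_mem_div_self M
  have hΛΛ : (M / M) * (M / M) ≤ M / M := (div_self_mul_div_self M).le
  -- `Λ = 𝒪(L)` acts on `L` and on `L' = Λ:L`, and `L·L' = Λ`
  have hΛM : ∀ z ∈ M / M, ∀ m ∈ M, z * m ∈ M := fun z hz m hm =>
    (Submodule.mem_div_iff_forall_mul_mem.1 hz) m hm
  have hΛM' : ∀ z ∈ M / M, ∀ y ∈ (M / M) / M, z * y ∈ (M / M) / M := fun z hz y hy => by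
    rw [Submodule.mem_div_iff_forall_mul_mem] at hy ⊢
    intro m hm
    rw [mul_assoc]
    exact hΛΛ (Submodule.mul_mem_mul hz (hy m hm))
  have hMM' : ∀ x ∈ M, ∀ y ∈ (M / M) / M, x * y ∈ M / M := fun x hx y hy => by
    rw [← hinv]
    exact Submodule.mul_mem_mul hx hy
  -- the commutative ring `S = Λ`
  let S : Subring A :=
    { carrier := ((M / M : Submodule ℤ A) : Set A)
      mul_mem' := fun ha hb => hΛΛ (Submodule.mul_mem_mul ha hb)
      one_mem' := h1
      add_mem' := fun ha hb => (M / M).add_mem ha hb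
      zero_mem' := (M / M).zero_mem
      neg_mem' := fun ha => (M / M).neg_mem ha }
  -- an ideal `𝔪 ⊆ S` seen inside `A`
  let g : Ideal S → Submodule ℤ A := fun 𝔪 =>
    AddSubgroup.toIntSubmodule ((Submodule.toAddSubgroup 𝔪).map (S.subtype : S →+* A).toAddMonoidHom)
  have hg' : ∀ (𝔪 : Ideal S) (z : A), z ∈ g 𝔪 ↔ ∃ s ∈ 𝔪, (s : A) = z := fun 𝔪 z => by
    rw [← SetLike.mem_coe, AddSubgroup.coe_toIntSubmodule, SetLike.mem_coe, AddSubgroup.mem_map]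
    simp only [Submodule.mem_toAddSubgroup, RingHom.toAddMonoidHom_eq_coe, AddMonoidHom.coe_coe,
      Subring.subtype_apply]
  have hg : ∀ (𝔪 : Ideal S) (s : S), (s : A) ∈ g 𝔪 ↔ s ∈ 𝔪 := fun 𝔪 s => by
    rw [hg']
    exact ⟨fun ⟨s', hs', h⟩ => Subtype.ext h ▸ hs', fun h => ⟨s, h, rfl⟩⟩
  have hgΛ : ∀ (𝔪 : Ideal S), g 𝔪 ≤ M / M := fun 𝔪 z hz => by
    obtain ⟨s, -, rfl⟩ := (hg' 𝔪 z).1 hz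
    exact s.2
  -- the maximal ideals of `S` above `p` are finitely many (additive groups between `pΛ` and `Λ`)
  haveI : IsAddTorsionFree A := IsAddTorsionFree.of_isTorsionFree ℚ A
  have hfin : {𝔪 : Ideal S | 𝔪.IsMaximal ∧ (p : S) ∈ 𝔪}.Finite := by
    have hW := finite_setOf_le_and_smul_mem (M / M) hΛ.1 (n := (p : ℤ)) (Int.natCast_ne_zero.2 hp.ne_zero)
    refine Set.Finite.of_finite_image (f := g) (hW.subset ?_) fun 𝔪 _ 𝔪' _ h => ?_
    · rintro _ ⟨𝔪, ⟨-, hp𝔪⟩, rfl⟩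
      refine ⟨hgΛ 𝔪, fun z hz => ?_⟩
      have h2 := (hg 𝔪 _).2 (Ideal.mul_mem_right (⟨z, hz⟩ : S) _ hp𝔪)
      rw [zsmul_eq_mul, Int.cast_natCast]
      simpa using h2
    · ext s
      rw [← hg 𝔪 s, ← hg 𝔪' s, h]
  haveI : Finite {𝔪 : Ideal S // 𝔪.IsMaximal ∧ (p : S) ∈ 𝔪} := hfin.to_subtype
  letI : Fintype {𝔪 : Ideal S // 𝔪.IsMaximal ∧ (p : S) ∈ 𝔪} := Fintype.ofFinite _
  -- for each maximal `𝔪 ∋ p`: `x_𝔪 ∈ L`, `y_𝔪 ∈ L'` with `x_𝔪 y_𝔪 ∉ 𝔪` (as `LL' = Λ ⊄ 𝔪`)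
  have hxy : ∀ 𝔪 : {𝔪 : Ideal S // 𝔪.IsMaximal ∧ (p : S) ∈ 𝔪},
      ∃ x ∈ M, ∃ y ∈ (M / M) / M, x * y ∉ g 𝔪 := by
    intro 𝔪
    by_contra! hall
    have hle : M * ((M / M) / M) ≤ g 𝔪 := Submodule.mul_le.2 fun x hx y hy => hall x hx y hy
    have h1g : ((1 : S) : A) ∈ g 𝔪 := hle (by rw [hinv]; exact h1)
    exact 𝔪.2.1.ne_top ((Ideal.eq_top_iff_one _).2 ((hg _ _).1 h1g))
  choose x hxM y hyM' hxy using hxy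
  -- Chinese remainder: `e_𝔪 ≡ 1 (mod 𝔪)`, `e_𝔪 ≡ 0 (mod 𝔪')` for `𝔪' ≠ 𝔪`
  have hcop : Pairwise (IsCoprime on fun 𝔪 : {𝔪 : Ideal S // 𝔪.IsMaximal ∧ (p : S) ∈ 𝔪} => (𝔪 : Ideal S)) :=
    fun 𝔪 𝔪' hne => (Ideal.isCoprime_iff_sup_eq).2 (𝔪.2.1.coprime_of_ne 𝔪'.2.1 fun h => hne (Subtype.ext h))
  have he : ∀ 𝔪 : {𝔪 : Ideal S // 𝔪.IsMaximal ∧ (p : S) ∈ 𝔪}, ∃ e : S, e - 1 ∈ (𝔪 : Ideal S) ∧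
      ∀ 𝔪' : {𝔪 : Ideal S // 𝔪.IsMaximal ∧ (p : S) ∈ 𝔪}, 𝔪' ≠ 𝔪 → e ∈ (𝔪' : Ideal S) := by
    intro 𝔪
    obtain ⟨r, hr⟩ := Ideal.pi_quotient_surjective hcop (Pi.single 𝔪 1)
    refine ⟨r, ?_, fun 𝔪' hne => ?_⟩
    · have h := hr 𝔪
      rw [Pi.single_eq_same] at h
      exact Ideal.Quotient.eq.1 (h.trans (map_one _).symm)
    · have h := hr 𝔪'
      rw [Pi.single_eq_of_ne hne] at h
      exact Ideal.Quotient.eq_zero_iff_mem.1 h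
  choose e he1 he0 using he
  -- `a := Σ e_𝔪 x_𝔪 ∈ L`
  set a : A := ∑ 𝔪, (e 𝔪 : A) * x 𝔪 with ha_def
  have haM : a ∈ M := M.sum_mem fun 𝔪 _ => hΛM _ (e 𝔪).2 _ (hxM 𝔪)
  -- `a y_𝔪 ≡ x_𝔪 y_𝔪 ≢ 0 (mod 𝔪)`
  have hay : ∀ 𝔪 : {𝔪 : Ideal S // 𝔪.IsMaximal ∧ (p : S) ∈ 𝔪}, a * y 𝔪 ∉ g 𝔪 := by
    intro 𝔪 hmem
    apply hxy 𝔪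
    have hdiff : a * y 𝔪 - x 𝔪 * y 𝔪 ∈ g 𝔪 := by
      have hsplit : a * y 𝔪 - x 𝔪 * y 𝔪 = ((e 𝔪 : A) - 1) * (x 𝔪 * y 𝔪) +
          ∑ 𝔪' ∈ Finset.univ.erase 𝔪, (e 𝔪' : A) * (x 𝔪' * y 𝔪) := by
        rw [ha_def, Finset.sum_mul, ← Finset.add_sum_erase _ _ (Finset.mem_univ 𝔪)]
        simp only [mul_assoc]
        ring
      rw [hsplit]
      refine add_mem ?_ (Submodule.sum_mem _ fun 𝔪' h𝔪' => ?_)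
      · have h := (hg 𝔪 ((e 𝔪 - 1) * ⟨x 𝔪 * y 𝔪, hMM' _ (hxM 𝔪) _ (hyM' 𝔪)⟩)).2
          (Ideal.mul_mem_right _ _ (he1 𝔪))
        simpa using h
      · have h := (hg 𝔪 (e 𝔪' * ⟨x 𝔪' * y 𝔪, hMM' _ (hxM 𝔪') _ (hyM' 𝔪)⟩)).2
          (Ideal.mul_mem_right _ _ (he0 𝔪' 𝔪 (Finset.ne_of_mem_erase h𝔪').symm))
        simpa using h
    have h := (g 𝔪).sub_mem hmem hdiff
    rwa [sub_sub_cancel] at h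
  -- the ideal `aL' + pΛ` of `S` is everything
  let w : {𝔪 : Ideal S // 𝔪.IsMaximal ∧ (p : S) ∈ 𝔪} → S := fun 𝔪 => ⟨a * y 𝔪, hMM' _ haM _ (hyM' 𝔪)⟩
  have hI : Ideal.span (Set.range w) ⊔ Ideal.span {(p : S)} = ⊤ := by
    by_contra hne
    obtain ⟨𝔪₀, h𝔪₀, hle⟩ := Ideal.exists_le_maximal _ hne
    have hp𝔪₀ : (p : S) ∈ 𝔪₀ := hle (Ideal.mem_sup_right (Ideal.mem_span_singleton_self _))
    have hw : w ⟨𝔪₀, h𝔪₀, hp𝔪₀⟩ ∈ 𝔪₀ := hle (Ideal.mem_sup_left (Ideal.subset_span ⟨_, rfl⟩))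
    exact hay ⟨𝔪₀, h𝔪₀, hp𝔪₀⟩ ((hg _ _).2 hw)
  obtain ⟨u, hu, v, hv, huv⟩ := Submodule.mem_sup.1 ((Ideal.eq_top_iff_one _).1 hI)
  obtain ⟨c, hc⟩ := Ideal.mem_span_range_iff_exists_fun.1 hu
  obtain ⟨d, hd⟩ := Ideal.mem_span_singleton'.1 hv
  -- `a·y' = 1 − p·d` with `y' = Σ c_𝔪 y_𝔪 ∈ L'`, `d ∈ Λ`
  set y' : A := ∑ 𝔪, (c 𝔪 : A) * y 𝔪 with hy'_def
  have hy'M' : y' ∈ (M / M) / M := Submodule.sum_mem _ fun 𝔪 _ => hΛM' _ (c 𝔪).2 _ (hyM' 𝔪)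
  have hay' : a * y' = 1 + (p : ℤ) • (-(d : A)) := by
    have huv' : ((u : S) : A) + (v : A) = 1 := by rw [← Subring.coe_add, huv]; rfl
    have hu' : ((u : S) : A) = a * y' := by
      rw [← hc, hy'_def, Finset.mul_sum]
      simp only [AddSubmonoidClass.coe_finsetSum, Subring.coe_mul, w]
      exact Finset.sum_congr rfl fun _ _ => by ring
    have hv' : ((v : S) : A) = (d : A) * p := by
      rw [← hd, Subring.coe_mul, Subring.coe_natCast]
    rw [← hu', zsmul_eq_mul, Int.cast_natCast]
    linear_combination huv' - hv'
  -- Nakayama: `a·y'·b = r·1`, `b ∈ Λ`, `p ∤ r`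
  obtain ⟨b, hb, r, hr, hbr⟩ := exists_mem_mul_eq_smul_one_of_one_add hΛ h1 hΛΛ hp ((M / M).neg_mem d.2)
  rw [← hay'] at hbr
  have hr0 : r ≠ 0 := fun h => hr (h ▸ dvd_zero _)
  have ha : IsUnit a := isUnit_of_mul_eq_smul_one hr0 (by rw [← hbr, mul_assoc])
  have haΛ : ha.unit • (M / M) ≤ M := fun z hz => by
    rw [mem_units_smul_submodule_iff, Units.smul_def, smul_eq_mul] at hz
    have h := hΛM _ hz _ haM
    rwa [mul_comm, ← mul_assoc, IsUnit.mul_val_inv, one_mul] at h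
  refine ⟨ha.unit, haM, haΛ, r, hr, fun m hm => ?_, fun z hz => M.smul_mem r (haΛ hz)⟩
  -- `r·m = a·(b(y'm))`
  rw [mem_units_smul_submodule_iff, Units.smul_def, smul_eq_mul]
  have e1 : ((ha.unit⁻¹ : Aˣ) : A) * (r • m) = b * (y' * m) := by
    calc ((ha.unit⁻¹ : Aˣ) : A) * (r • m)
        = ((ha.unit⁻¹ : Aˣ) : A) * ((r • (1 : A)) * m) := by
          rw [zsmul_eq_mul, zsmul_eq_mul, mul_one]
      _ = (((ha.unit⁻¹ : Aˣ) : A) * a) * (b * (y' * m)) := by rw [← hbr]; ring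
      _ = b * (y' * m) := by rw [ha.val_inv_mul, one_mul]
  rw [e1]
  refine hΛΛ (Submodule.mul_mem_mul hb ?_)
  have h := hMM' m hm y' hy'M'
  rwa [mul_comm] at h

/-! ## §2 Theorem 7.3 [Fa65]: invertible ⟺ locally principal (`a_p = 1` for almost all `p`) -/

/-- **THEOREM 7.3 «⇒» [Fa65]: an INVERTIBLE full lattice `L` is LOCALLY PRINCIPAL — there are units `a_p ∈ A^unit`,
`a_p = 1` off a finite set `P₀` of primes and `a_p ∈ L`, `a_p𝒪(L) ⊆ L` for `p ∈ P₀`, with `L_(p) = a_p𝒪(L)_(p)`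
for every prime `p`** (`P₀` = the finitely many primes with `L_(p) ≠ 𝒪(L)_(p)`, Thm. 7.2 (b)).
[cite: HertlingLarabi2026, §7 Thm. 7.3 ⇒ («with a_p = 1_A for all except finitely many p»; «in [Fa65] only the more difficult implication ⇒ is proved»), chunk p0018]
[cite: Faddeev1965, as cited by HertlingLarabi2026 §7 Thm. 7.3] -/
theorem exists_forall_prime_locEq_units_smul_of_mul_div_div_eq' {M : Submodule ℤ A}
    (hM : IsFullLattice A M) (hinv : M * ((M / M) / M) = M / M) :
    ∃ a : ℕ → Aˣ, ∃ P₀ : Finset ℕ, (∀ p ∉ P₀, a p = 1) ∧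
      (∀ p ∈ P₀, (a p : A) ∈ M ∧ a p • (M / M) ≤ M) ∧
      ∀ p : ℕ, p.Prime → ∃ s : ℤ, ¬ (p : ℤ) ∣ s ∧
        (∀ x ∈ M, s • x ∈ a p • (M / M)) ∧ (∀ x ∈ a p • (M / M), s • x ∈ M) := by
  classical
  have hΛ : IsFullLattice A (M / M) := isFullLattice_div hM hM
  have hF := finite_setOf_prime_not_locEq hM hΛ
  choose f hf using fun (p : ℕ) (hp : p.Prime) => exists_units_mem_locEq_smul_of_mul_div_div_eq hM hinv hp
  refine ⟨fun p => if h : p ∈ hF.toFinset then f p (hF.mem_toFinset.1 h).1 else 1, hF.toFinset,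
    fun p hp => dif_neg hp, fun p hp => ?_, fun p hp => ?_⟩
  · simp only [dif_pos hp]
    exact ⟨(hf p _).1, (hf p _).2.1⟩
  · by_cases h : p ∈ hF.toFinset
    · simp only [dif_pos h]
      exact (hf p _).2.2
    · simp only [dif_neg h, one_smul]
      by_contra hne
      exact h (hF.mem_toFinset.2 ⟨hp, hne⟩)

/-- **THEOREM 7.3 «⇒» [Fa65]** in the shape of the «⇐» of `FiniteQAlgebraLatticeLocalization`: an invertible full lattice `L` has
`L_(p) = a_p𝒪(L)_(p)` for all primes `p`, with `a_p ∈ A^unit` and `a_p = 1` for all but finitely many `p`.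
[cite: HertlingLarabi2026, §7 Thm. 7.3 ⇒, chunk p0018] [cite: Faddeev1965, as cited by HertlingLarabi2026 §7 Thm. 7.3] -/
theorem exists_forall_prime_locEq_units_smul_of_mul_div_div_eq {M : Submodule ℤ A}
    (hM : IsFullLattice A M) (hinv : M * ((M / M) / M) = M / M) :
    ∃ a : ℕ → Aˣ, ∃ P₀ : Finset ℕ, (∀ p ∉ P₀, a p = 1) ∧
      ∀ p : ℕ, p.Prime → ∃ s : ℤ, ¬ (p : ℤ) ∣ s ∧
        (∀ x ∈ M, s • x ∈ a p • (M / M)) ∧ (∀ x ∈ a p • (M / M), s • x ∈ M) := by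
  obtain ⟨a, P₀, ha, -, hloc⟩ := exists_forall_prime_locEq_units_smul_of_mul_div_div_eq' hM hinv
  exact ⟨a, P₀, ha, hloc⟩

/-- **THEOREM 7.3 [Fa65] (both directions): a full lattice `L ⊂ A` is INVERTIBLE (`L·(𝒪(L):L) = 𝒪(L)`) iff it is
LOCALLY PRINCIPAL: `L_(p) = a_p𝒪(L)_(p)` for every prime `p`, `a_p ∈ A^unit`, `a_p = 1` for almost all `p`.**
(«⇐» is `mul_div_div_eq_of_forall_prime_locEq_units_smul` of `FiniteQAlgebraLatticeLocalization`, by gluing.)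
[cite: HertlingLarabi2026, §7 Thm. 7.3, chunk p0018] [cite: Faddeev1965, as cited by HertlingLarabi2026 §7 Thm. 7.3]
[cite: NeukirchANT1999, I §12 Prop. (12.4) (the one-field case: invertibility of `𝒪`-ideals is a local property)] -/
theorem mul_div_div_eq_iff_exists_forall_prime_locEq_units_smul {M : Submodule ℤ A}
    (hM : IsFullLattice A M) :
    M * ((M / M) / M) = M / M ↔
      ∃ a : ℕ → Aˣ, ∃ P₀ : Finset ℕ, (∀ p ∉ P₀, a p = 1) ∧
        ∀ p : ℕ, p.Prime → ∃ s : ℤ, ¬ (p : ℤ) ∣ s ∧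
          (∀ x ∈ M, s • x ∈ a p • (M / M)) ∧ (∀ x ∈ a p • (M / M), s • x ∈ M) :=
  ⟨exists_forall_prime_locEq_units_smul_of_mul_div_div_eq hM,
    fun ⟨a, P₀, ha, hloc⟩ => mul_div_div_eq_of_forall_prime_locEq_units_smul hM a P₀ ha hloc⟩

/-- **THEOREM 7.3 [Fa65], POINTWISE FORM: a full lattice `L` is invertible iff for EVERY prime `p` there is a unit
`a ∈ A^unit` with `L_(p) = a𝒪(L)_(p)`** — the bookkeeping «`a_p = 1` for almost all `p`» is automatic, because
`L_(p) = 𝒪(L)_(p)` for all but finitely many `p` (Thm. 7.2 (b)). [cite: HertlingLarabi2026, §7 Thm. 7.3 with Thm. 7.2 (b), chunk p0018]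
[cite: Faddeev1965, as cited by HertlingLarabi2026 §7 Thm. 7.3] -/
theorem mul_div_div_eq_iff_forall_prime_exists_units_locEq {M : Submodule ℤ A}
    (hM : IsFullLattice A M) :
    M * ((M / M) / M) = M / M ↔
      ∀ p : ℕ, p.Prime → ∃ a : Aˣ, ∃ s : ℤ, ¬ (p : ℤ) ∣ s ∧
        (∀ x ∈ M, s • x ∈ a • (M / M)) ∧ (∀ x ∈ a • (M / M), s • x ∈ M) := by
  classical
  refine ⟨fun h p hp => ?_, fun h => ?_⟩
  · obtain ⟨a, -, -, hloc⟩ := exists_units_mem_locEq_smul_of_mul_div_div_eq hM h hp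
    exact ⟨a, hloc⟩
  · have hΛ : IsFullLattice A (M / M) := isFullLattice_div hM hM
    have hF := finite_setOf_prime_not_locEq hM hΛ
    choose f hf using h
    refine (mul_div_div_eq_iff_exists_forall_prime_locEq_units_smul hM).2
      ⟨fun p => if h : p ∈ hF.toFinset then f p (hF.mem_toFinset.1 h).1 else 1, hF.toFinset,
        fun p hp => dif_neg hp, fun p hp => ?_⟩
    by_cases h : p ∈ hF.toFinset
    · simp only [dif_pos h]
      exact hf p _
    · simp only [dif_neg h, one_smul]
      by_contra hne
      exact h (hF.mem_toFinset.2 ⟨hp, hne⟩)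

/-! ## §3 Remark 7.4 [Fa65]: `w`-equivalence ⟺ local equivalence -/

/-- **REMARK 7.4 «⇒» [Fa65]: WEAKLY EQUIVALENT full lattices are LOCALLY EQUIVALENT — if `1 ∈ (L₁:L₂)(L₂:L₁)`
then `(L₂)_(p) = a_p(L₁)_(p)` for every prime `p`, with `a_p ∈ A^unit`, `a_p = 1` for almost all `p`** (apply
Thm. 7.3 ⇒ to the invertible lattice `L₃ = L₂:L₁ ∈ G(𝒪(L₁))` with `L₃L₁ = L₂`).
[cite: HertlingLarabi2026, §7 Rem. 7.4 («By Theorem 7.3 this is equivalent to (L₂)_(p) = a_p·(L₁)_(p) for each p»), chunk p0018]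
[cite: Faddeev1965, as cited by HertlingLarabi2026 §7 Rem. 7.4 («w-equivalence and local equivalence coincide [Fa65]»)] -/
theorem exists_forall_prime_locEq_units_smul_of_one_mem_div_mul_div {L₁ L₂ : Submodule ℤ A}
    (hL₁ : IsFullLattice A L₁) (hL₂ : IsFullLattice A L₂)
    (h : (1 : A) ∈ (L₁ / L₂) * (L₂ / L₁)) :
    ∃ a : ℕ → Aˣ, ∃ P₀ : Finset ℕ, (∀ p ∉ P₀, a p = 1) ∧
      ∀ p : ℕ, p.Prime → ∃ s : ℤ, ¬ (p : ℤ) ∣ s ∧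
        (∀ x ∈ L₂, s • x ∈ a p • L₁) ∧ (∀ x ∈ a p • L₁, s • x ∈ L₂) := by
  have h' : (1 : A) ∈ (L₂ / L₁) * (L₁ / L₂) := by rwa [mul_comm]
  have hL₃ : IsFullLattice A (L₂ / L₁) := isFullLattice_div hL₂ hL₁
  have hinv := div_mul_inv_eq_of_one_mem h'
  have hO : (L₂ / L₁) / (L₂ / L₁) = L₁ / L₁ := by
    rw [div_self_div_eq_div_self_of_one_mem h', div_self_eq_div_self_of_one_mem h]
  obtain ⟨a, P₀, ha, hloc⟩ := exists_forall_prime_locEq_units_smul_of_mul_div_div_eq hL₃ hinv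
  refine ⟨a, P₀, ha, fun p hp => ?_⟩
  have hl := locEq_mul hp (hloc p hp) (locEq_refl hp L₁)
  rwa [div_mul_eq_of_one_mem h, hO, ← units_smul_mul, div_self_mul_eq_self] at hl

/-- **REMARK 7.4 [Fa65]: «in our commutative situation w-equivalence and local equivalence coincide» — for full
lattices `L₁, L₂ ⊂ A`: `1 ∈ (L₁:L₂)(L₂:L₁)` iff `(L₂)_(p) = a_p(L₁)_(p)` for all primes `p` (`a_p ∈ A^unit`,
`a_p = 1` for almost all `p`).** («⇐» is `one_mem_div_mul_div_of_forall_prime_locEq_units_smul` of `FiniteQAlgebraLatticeLocalization`.)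
[cite: HertlingLarabi2026, §7 Rem. 7.4, chunks p0018–p0019] [cite: Faddeev1965, as cited by HertlingLarabi2026 §7 Rem. 7.4]
[cite: DadeTausskyZassenhaus1962, §1 (weak equivalence), as cited by HertlingLarabi2026 §5] -/
theorem one_mem_div_mul_div_iff_exists_forall_prime_locEq_units_smul {L₁ L₂ : Submodule ℤ A}
    (hL₁ : IsFullLattice A L₁) (hL₂ : IsFullLattice A L₂) :
    (1 : A) ∈ (L₁ / L₂) * (L₂ / L₁) ↔
      ∃ a : ℕ → Aˣ, ∃ P₀ : Finset ℕ, (∀ p ∉ P₀, a p = 1) ∧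
        ∀ p : ℕ, p.Prime → ∃ s : ℤ, ¬ (p : ℤ) ∣ s ∧
          (∀ x ∈ L₂, s • x ∈ a p • L₁) ∧ (∀ x ∈ a p • L₁, s • x ∈ L₂) :=
  ⟨exists_forall_prime_locEq_units_smul_of_one_mem_div_mul_div hL₁ hL₂,
    fun ⟨a, P₀, ha, hloc⟩ => one_mem_div_mul_div_of_forall_prime_locEq_units_smul hL₁ hL₂ a P₀ ha hloc⟩

/-- **REMARK 7.4 [Fa65], POINTWISE FORM: full lattices `L₁, L₂` are weakly equivalent (`1 ∈ (L₁:L₂)(L₂:L₁)`) iff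
for EVERY prime `p` there is a unit `a ∈ A^unit` with `(L₂)_(p) = a(L₁)_(p)`** («`a_p = 1` for almost all `p`» is
automatic by Thm. 7.2 (b)). [cite: HertlingLarabi2026, §7 Rem. 7.4 with Thm. 7.2 (b), chunks p0018–p0019]
[cite: Faddeev1965, as cited by HertlingLarabi2026 §7 Rem. 7.4] -/
theorem one_mem_div_mul_div_iff_forall_prime_exists_units_locEq {L₁ L₂ : Submodule ℤ A}
    (hL₁ : IsFullLattice A L₁) (hL₂ : IsFullLattice A L₂) :
    (1 : A) ∈ (L₁ / L₂) * (L₂ / L₁) ↔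
      ∀ p : ℕ, p.Prime → ∃ a : Aˣ, ∃ s : ℤ, ¬ (p : ℤ) ∣ s ∧
        (∀ x ∈ L₂, s • x ∈ a • L₁) ∧ (∀ x ∈ a • L₁, s • x ∈ L₂) := by
  classical
  refine ⟨fun h p hp => ?_, fun h => ?_⟩
  · obtain ⟨a, -, -, hloc⟩ := exists_forall_prime_locEq_units_smul_of_one_mem_div_mul_div hL₁ hL₂ h
    exact ⟨a p, hloc p hp⟩
  · have hF := finite_setOf_prime_not_locEq hL₂ hL₁
    choose f hf using h
    refine (one_mem_div_mul_div_iff_exists_forall_prime_locEq_units_smul hL₁ hL₂).2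
      ⟨fun p => if h : p ∈ hF.toFinset then f p (hF.mem_toFinset.1 h).1 else 1, hF.toFinset,
        fun p hp => dif_neg hp, fun p hp => ?_⟩
    by_cases h : p ∈ hF.toFinset
    · simp only [dif_pos h]
      exact hf p _
    · simp only [dif_neg h, one_smul]
      by_contra hne
      exact h (hF.mem_toFinset.2 ⟨hp, hne⟩)

/-! ## §4 Theorem 8.2 (b), Step 1: `G(Λ₂) → G(Λ₁)`, `L ↦ Λ₁L`, is surjective for orders `Λ₂ ⊆ Λ₁` -/

omit [Algebra ℚ A] in
/-- For orders `Λ₂ ⊆ Λ₁` of `A`: `Λ₁Λ₂ = Λ₁`. [cite: HertlingLarabi2026, §8 Lemma 8.1 (b) (proof: «(Λ₁L)L⁻¹ = Λ₁Λ₂ = Λ₁»), chunk p0021] -/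
theorem order_mul_order_eq_of_le {Λ₁ Λ₂ : Submodule ℤ A} (hΛ₁Λ₁ : Λ₁ * Λ₁ ≤ Λ₁)
    (h2 : (1 : A) ∈ Λ₂) (hle : Λ₂ ≤ Λ₁) : Λ₁ * Λ₂ = Λ₁ :=
  le_antisymm ((mul_le_mul_right hle _).trans hΛ₁Λ₁) fun x hx => by
    rw [← mul_one x]
    exact Submodule.mul_mem_mul hx h2

/-- **THEOREM 8.2 (b), STEP 1 (surjectivity of (8.1)): for orders `Λ₂ ⊆ Λ₁` of `A` and every `L₁ ∈ G(Λ₁)`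
(full, `𝒪(L₁) = Λ₁`, invertible) there is `L₂ ∈ G(Λ₂)` (full, `𝒪(L₂) = Λ₂`, invertible) with `Λ₁L₂ = L₁`** —
«`(L₁)_(p) = b_p(Λ₁)_(p)` by Theorem 7.3; … there is a unique full lattice `L₂` with `(L₂)_(p) = b_p(Λ₂)_(p)` for
each `p` … By Theorem 7.3 it is in `G(Λ₂)`. Now `(Λ₁L₂)_(p) = b_p(Λ₁)_(p)(Λ₂)_(p) = b_p(Λ₁)_(p) = (L₁)_(p)` …
so `Λ₁L₂ = L₁`.» This generalises to arbitrary orders of an arbitrary `A` the surjectivity `Pic(𝒪) → Pic(𝒪_K)` of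
the one-field case. [cite: HertlingLarabi2026, §8 Thm. 8.2 (b) («Especially, the group homomorphism in (8.1) is surjective»), proof Step 1, chunk p0021]
[cite: NeukirchANT1999, I §12 Prop. (12.9) (the one-field exact sequence `… → Pic(𝒪) → Pic(𝒪_K) → 1`, hence surjectivity)] -/
theorem exists_invertible_order_mul_eq {Λ₁ Λ₂ L₁ : Submodule ℤ A}
    (hΛ₁Λ₁ : Λ₁ * Λ₁ ≤ Λ₁) (hΛ₂ : IsFullLattice A Λ₂) (h2 : (1 : A) ∈ Λ₂)
    (hΛ₂Λ₂ : Λ₂ * Λ₂ ≤ Λ₂) (hle : Λ₂ ≤ Λ₁) (hL₁ : IsFullLattice A L₁) (hO₁ : L₁ / L₁ = Λ₁)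
    (hinv₁ : L₁ * ((L₁ / L₁) / L₁) = L₁ / L₁) :
    ∃ L₂ : Submodule ℤ A, IsFullLattice A L₂ ∧ L₂ / L₂ = Λ₂ ∧
      L₂ * ((L₂ / L₂) / L₂) = L₂ / L₂ ∧ Λ₁ * L₂ = L₁ := by
  obtain ⟨a, P₀, ha, hloc⟩ := exists_forall_prime_locEq_units_smul_of_mul_div_div_eq hL₁ hinv₁
  rw [hO₁] at hloc
  -- glue `L₂` from `b_pΛ₂`
  obtain ⟨L₂, hL₂, hL₂U⟩ := exists_isFullLattice_forall_prime_locEq hΛ₂ (U := fun p => a p • Λ₂)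
    (fun p => IsFullLattice.units_smul _ hΛ₂) P₀ (fun p hp => by simp only [ha p hp, one_smul])
  have hΛ₂O : Λ₂ / Λ₂ = Λ₂ := div_self_eq_of_one_mem h2 hΛ₂Λ₂
  -- `𝒪(L₂)_(p) = 𝒪(b_pΛ₂)_(p) = (Λ₂)_(p)`, so `𝒪(L₂) = Λ₂`
  have hO₂ : L₂ / L₂ = Λ₂ := eq_of_forall_prime_locEq fun p hp => by
    have h := locEq_div hp (hL₂U p hp) (hL₂U p hp)
    rwa [div_self_units_smul, hΛ₂O] at h
  -- `L₂` is locally principal for `Λ₂`, hence invertible (Thm. 7.3 ⇐)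
  have hinv₂ : L₂ * ((L₂ / L₂) / L₂) = L₂ / L₂ :=
    mul_div_div_eq_of_forall_prime_locEq_units_smul hL₂ a P₀ ha fun p hp => by
      rw [hO₂]; exact hL₂U p hp
  refine ⟨L₂, hL₂, hO₂, hinv₂, eq_of_forall_prime_locEq fun p hp => ?_⟩
  -- `(Λ₁L₂)_(p) = b_pΛ₁Λ₂ = b_pΛ₁ = (L₁)_(p)`
  have h := locEq_mul hp (locEq_refl hp Λ₁) (hL₂U p hp)
  rw [mul_comm Λ₁ (a p • Λ₂), ← units_smul_mul, mul_comm Λ₂ Λ₁, order_mul_order_eq_of_le hΛ₁Λ₁ h2 hle] at h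
  exact locEq_trans hp h (locEq_symm (hloc p hp))

/-- **THEOREM 8.2 (b), STEP 1, for the MAXIMAL ORDER: every `L₁ ∈ G(𝒪_Y)`-type statement specialises; here the
general form with `Λ₁ = 𝒪(L₁)` read off from `L₁`: for an order `Λ₂ ⊆ 𝒪(L₁)` and an invertible full lattice
`L₁` there is an invertible `L₂` with exact order `Λ₂` and `𝒪(L₁)·L₂ = L₁`.**
[cite: HertlingLarabi2026, §8 Thm. 8.2 (b) Step 1, chunk p0021] -/
theorem exists_invertible_div_self_mul_eq {Λ₂ L₁ : Submodule ℤ A}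
    (hΛ₂ : IsFullLattice A Λ₂) (h2 : (1 : A) ∈ Λ₂) (hΛ₂Λ₂ : Λ₂ * Λ₂ ≤ Λ₂)
    (hle : Λ₂ ≤ L₁ / L₁) (hL₁ : IsFullLattice A L₁) (hinv₁ : L₁ * ((L₁ / L₁) / L₁) = L₁ / L₁) :
    ∃ L₂ : Submodule ℤ A, IsFullLattice A L₂ ∧ L₂ / L₂ = Λ₂ ∧
      L₂ * ((L₂ / L₂) / L₂) = L₂ / L₂ ∧ (L₁ / L₁) * L₂ = L₁ :=
  exists_invertible_order_mul_eq (div_self_mul_div_self L₁).le hΛ₂ h2 hΛ₂Λ₂ hle hL₁ rfl hinv₁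

end LocallyPrincipal

end Literature.NumberTheory.ComplexMultiplication.FiniteQAlgebraLattice
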